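import Summits.RiemannHypothesis.RiemannHypothesis.Theses.OddSector
import Summits.RiemannHypothesis.RiemannHypothesis.Theorems.OddSectorOddOneSignedWindowsExistence
import Summits.RiemannHypothesis.RiemannHypothesis.Theorems.OddSectorOddOneSignedWindowsLayerDefs
import Summits.RiemannHypothesis.RiemannHypothesis.Theorems.OddSectorOddOneSignedWindowsBulkIff
import Literature.NumberTheory.LFunctions.WeilOddGroundState
import Literature.NumberTheory.LFunctions.WeilMarkovQuadratic
import Mathlib.Data.Real.Sign
import HarnessLib

/-!
# Skeleton — crux `OddSector.OddOneSignedWindows` (stmt-RiemannHypothesis-17778), line `Sketch`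
(idea card `log-coercive-origin-layer`, VARIATIONAL form) — reshaped after wave 1 (2026-08-17)

LANDED (RH-free, all `--supports stmt-RiemannHypothesis-17778`):
* `stub_foldPrimeIncrement` (p148598, Theorems/OddSectorOddOneSignedWindowsFoldPrimeIncrement),
* `stub_smoothFoldRadial` (p149561, …SmoothFoldRadial),
* `stub_foldArchGain` (p150648, …FoldArchGain),
* `stub_archGainLiminf` (p150734, …ArchGainLiminf),
* `stub_tendsto_weilPoleForm` (p150388, …PoleFormTendsto),
* `stub_originLayerLemma` (p151407, …OriginLayer): the RH-free ORIGIN-LAYER LEMMA — for a real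
  odd ground state `u` with bulk sign on `[η, a)` and layer domination on `(0, η)`, `sign·|u|` is
  an odd ground state.

What remains registered here:
* (landed too: `stub_oddOneSignedWindows_iff_bulkSignPattern`, p151717, …BulkIff — RH-free: the crux is
  EQUIVALENT to its robust bulk form, for every layer width `0 < η ≤ log 2`.)
* `stub_oddBulkSignPattern` — the robust bulk form itself: RH-STRENGTH and, by the previous
  item, equivalent to the crux. The line has no RH-free residue left.

Composition `OddOneSignedWindows_of`: by name from the landed iff and the one open stub.
-/

noncomputable section

set_option linter.dupNamespace false

open Complex Filter Set MeasureTheory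
open scoped Real Topology

namespace Summit.RiemannHypothesis.RiemannHypothesis.Theorems.OddSector

open Literature.NumberTheory.LFunctions
open Summit.RiemannHypothesis.RiemannHypothesis.Theses.OddSector (OddOneSignedWindows)

/-- **RH-strength stub (the robust bulk form of the crux; equivalent to the crux by
`stub_oddOneSignedWindows_iff_bulkSignPattern`).** Beyond every height there is a window `a ≥ 1`
carrying a REAL odd-sector ground state `u` which is `≥ 0` a.e. on the bulk `[1/20, a)` and whose
prime defect is dominated by the archimedean glue at a.e. point of the origin layer `(0, 1/20)`
where `u < 0`. -/
theorem stub_oddBulkSignPattern :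
    ∀ A : ℝ, ∃ a : ℝ, A ≤ a ∧ 1 ≤ a ∧ ∃ u : ℝ → ℂ, IsWeilOddGroundState a u ∧
      (∀ t, (u t).im = 0) ∧
      (∀ᵐ t : ℝ, t ∈ Ico (1 / 20 : ℝ) a → 0 ≤ (u t).re) ∧
      (∀ᵐ x : ℝ, x ∈ Ioo (0 : ℝ) (1 / 20) → (u x).re < 0 →
        layerPrimeDefect a u x ≤ layerArchGlue a (1 / 20) u x) := by
  sorry

/-- **The crux from the two stubs (kernel-checked composition).** -/
theorem OddOneSignedWindows_of : OddOneSignedWindows :=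
  stub_oddOneSignedWindows_iff_bulkSignPattern.2 stub_oddBulkSignPattern

end Summit.RiemannHypothesis.RiemannHypothesis.Theorems.OddSector

end
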